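import Literature.Topology.FourManifolds.SphereSurgeryHandleMeridian
import Literature.Topology.FourManifolds.SphereSurgeryStep
import HarnessLib

/-!
# Surgery in the middle dimension, II: the parallel of the torus and the vanishing of `Hₖ`
# of the surgered manifold (Kervaire–Milnor 1963, Lemma 5.6 and Lemma 7.1)

Topic `Literature/Topology/FourManifolds`; sequel of `SphereSurgeryHandleMeridian.lean`, toward
the surgical step of M. Kervaire, J. Milnor, *Groups of homotopy spheres I*, Ann. of Math. 77
(1963), Lemma 7.1 (pp. 526–528; tree: hypothesis `h71` of
`HomotopySphere.mk_eq_mk_iff_sigmaGen_dvd_sub_of_lemma71`, `HomotopySpheresSignatureLemma71.lean`,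
under the named fact `Literature.Topology.FourManifolds.HomotopySphere.mk_eq_mk_iff_sigmaGen_dvd_sub`,
Thm. 7.5). Everything here is **proved**; the only definitions (with bodies) are explicit maps
and subsets of the model pieces; no named fact is introduced (D-0026).

Setting: `ν` a framed family with ONE sphere `S = Sᵏ` and fibre `ℝˡ⁺¹` in a Hausdorff `X`, `P`
glued from `A = X ∖ S` and the handle `OD^{k+1} × Sˡ` (`hA hB hcov hrel`), as in the prequel. The
homology of `X` near `S` is read through a second Mayer–Vietoris sequence, that of the cover
`X = (X ∖ S) ∪ T` by the complement and the open unit tube `T = φ(Sᵏ × Bˡ⁺¹)`, with intersection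
the punctured tube `φ(Sᵏ × (Bˡ⁺¹ ∖ 0)) ≃ Sᵏ × Sˡ` (Kervaire–Milnor 1963, proof of Lemma 5.6,
pp. 515–516: `M₀ = M ∖ Int φ(Sᵏ × Dˡ⁺¹)`, the torus `φ(Sᵏ × Sˡ)`, the parallel class `ε` with
`i(ε) = λ`).

* `FramedSphereFamily.unitTube`, `openTube`, `complement_union_openTube`,
  `complement_inter_openTube` — the open unit tube `T = φ(Sᵏ × Bˡ⁺¹)` in `X`,
  `(X ∖ S) ∪ T = X`, `(X ∖ S) ∩ T = φ(punctured tube)`.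
* `mono_map_left_of_mono_inter_right` — **Mayer–Vietoris injectivity criterion**: for an open
  cover `X = U ∪ V`, if `Hₙ(U ∩ V) → Hₙ(V)` is injective then so is `Hₙ(U) → Hₙ(X)`
  (Hatcher 2002, §2.2, exactness at `Hₙ(U) ⊕ Hₙ(V)`).
* `FramedSphereFamily.mono_map_complement_val` — **`Hₖ(X ∖ S) → Hₖ(X)` is injective**
  (`k ≠ l`, `k, l ≥ 2`): the parallel generates `Hₖ` of the punctured tube and survives in the
  full tube `T ≃ Sᵏ` (`isIso_map_fstTube`), so `Hₖ((X ∖ S) ∩ T) → Hₖ(T)` is injective —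
  Kervaire–Milnor p. 516: "the homomorphisms `HₖM₀ → HₖM`… `ε` … is the homology class of the
  'parallel'" (their vertical sequence `ℤ →ε HₖM₀ → HₖM`).
* `FramedSphereFamily.map_jA_eq_zero_of_lagrangian` — **if every class of `Hₖ(X)` orthogonal to
  `S` (in the kernel of `Hₖ(X) → Hₖ(X, X ∖ S)`) is a multiple of `[S]`, then `Hₖ(X ∖ S)` dies in
  the surgered space `P`**: every class of `Hₖ(X ∖ S)` is then a multiple of the parallel
  (injectivity into `Hₖ(X)` and `i(ε) = λ`), and the parallel bounds a disc of the handle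
  (`map_jA_parallelSphere_eq_zero`). This is the case `r = 1` of Kervaire–Milnor's Lemma 7.1,
  p. 527: "The group `HₖM'` … has basis `{λ'₁, …, λ'ᵣ₋₁, μ'₁, …, μ'ᵣ₋₁}`" — empty for `r = 1`.
* `FramedSphereFamily.isZero_singularHomology_succ_of_middleSurgery` — **`Hₗ₊₁(P) = 0` for a
  surgery in the middle dimension `k = l + 1 ≥ 3` on a sphere `S` with `ker(Hₖ(X) → Hₖ(X, X ∖ S))
  ⊆ ℤ[S]`**: Mayer–Vietoris for `P`, with `Hₖ(X ∖ S) → Hₖ(P)` zero (previous item), `Hₖ` of the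
  handle zero (`OD × Sˡ ≃ Sˡ`, `k ≠ l`), and `Hₗ(jA(A) ∩ jB(B)) → Hₗ(jB(B))` injective (the
  meridian, `isIso_map_inter_right` of the prequel).
* `FramedSphereFamily.isZero_singularHomology_of_middleSurgery` — both degrees together: with
  moreover `Hₗ(X) = 0` and `Hₖ(X) → Hₖ(X, X ∖ S)` onto (the prequel's
  `isZero_singularHomology_of_middleSurgery_of_epi`), **`Hₗ(P) = 0` and `Hₗ₊₁(P) = 0`**:
  the homological content of Kervaire–Milnor's Lemma 7.1 for a single sphere (`r = 1`), i.e. of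
  the surgery on a primitive isotropic class `λ` with dual `μ` (`λ·λ = 0`, `λ·μ = 1`) spanning
  the middle homology.

* `NullCobordism.simplyConnected_and_isZero_surgery_of_middleSphere` — **read on a
  null-cobordism `M = ∂W`** (`n = 2l + 1`, `W` simply connected and `(k-1)`-connected, `k = l + 1`):
  surgery along one such framed `k`-sphere gives a null-cobordism of the same `M`
  (`NullCobordism.surgery`, boundary unchanged) which is simply connected with `Hᵢ = 0` for
  `0 < i ≤ k` — the conclusion of the hypothesis `h71` of
  `HomotopySphere.mk_eq_mk_iff_sigmaGen_dvd_sub_of_lemma71` in the rank-`2` case, GIVEN the framed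
  sphere with its two homological properties (the geometric input: Hurewicz, Haefliger's
  embedding, [17, Lemma 7], and "cup product = intersection number").

## References

* M. Kervaire, J. Milnor, *Groups of homotopy spheres I*, Ann. of Math. 77 (1963), p. 514,
  Lemma 5.6 (pp. 514–516), Thm. 6.6 (p. 526), Lemma 7.1 (pp. 526–528). [KervaireMilnorAnnals1963]
* A. Kosinski, *Differential Manifolds* (1993), Ch. X §1, Prop. (1.1), (1.3), §2 p. 201, §3 proof
  of Thm. (3.4). [Kosinski1993]
* A. Hatcher, *Algebraic Topology* (2002), §2.2 pp. 149–150 (Mayer–Vietoris). [HatcherAT2002]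
-/

noncomputable section

open scoped Manifold ContDiff Topology ContinuousMap
open CategoryTheory Limits Set Function Metric Topology
open Literature.AlgebraicTopology.SingularHomology

universe u v

namespace Literature.Topology.FourManifolds

/-- Local notation: `𝔼 n` is the model Euclidean space `EuclideanSpace ℝ (Fin n)`. -/
local notation "𝔼 " n:arg => EuclideanSpace ℝ (Fin n)

/-- Local notation: `𝕊 n` is the unit sphere in `EuclideanSpace ℝ (Fin (n + 1))`. -/
local notation "𝕊 " n:arg => (Metric.sphere (0 : EuclideanSpace ℝ (Fin (n + 1))) 1)

/-! ### A Mayer–Vietoris injectivity criterion (Hatcher §2.2) -/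

section MV

variable {Y : Type} [TopologicalSpace Y] (U V : Set Y)

/-- **If `Hₙ(U ∩ V) → Hₙ(V)` is injective then `Hₙ(U) → Hₙ(Y)` is injective** for an open cover
`Y = U ∪ V` (exactness of `Hₙ(U ∩ V) → Hₙ(U) ⊕ Hₙ(V) → Hₙ(Y)`, Hatcher 2002, §2.2 p. 149: if
`j_U x = 0` then `(x, 0) = (i_U c, -i_V c)` for some `c`, so `i_V c = 0`, `c = 0`, `x = 0`).
[cite: HatcherAT2002, §2.2 p. 149] -/
theorem mono_map_left_of_mono_inter_right (hU : IsOpen U) (hV : IsOpen V) (hUV : U ∪ V = univ)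
    (n : ℕ) (hmono : Mono (singularHomology.map ℤ ℤ
      (subsetInclusion (inter_subset_right : U ∩ V ⊆ V)) n)) :
    Mono (singularHomology.map ℤ ℤ (subsetIncl U) n) := by
  have hint : interior U ∪ interior V = univ := by rw [hU.interior_eq, hV.interior_eq, hUV]
  have hex := (mayerVietoris.exact₁_holds ℤ ℤ U V hint n)
  rw [ShortComplex.moduleCat_exact_iff] at hex
  rw [ModuleCat.mono_iff_injective] at hmono ⊢
  refine (injective_iff_map_eq_zero _).2 fun x hx => ?_
  -- `ψ (inl x) = j_U x = 0`, so `inl x = φ c`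
  have h1 : mayerVietoris.ψ ℤ ℤ U V n ((biprod.inl : _ ⟶ singularHomology ℤ ℤ ↥U n ⊞
      singularHomology ℤ ℤ ↥V n) x) = 0 := by
    rw [mayerVietoris.ψ, biprod_desc_inl_apply]
    exact hx
  obtain ⟨c, hc⟩ := hex _ h1
  -- second component: `-i_V c = 0`, hence `c = 0`
  have h2 : singularHomology.map ℤ ℤ (subsetInclusion (inter_subset_right : U ∩ V ⊆ V)) n c = 0 := by
    have h := congrArg (fun y => (biprod.snd : singularHomology ℤ ℤ ↥U n ⊞
      singularHomology ℤ ℤ ↥V n ⟶ singularHomology ℤ ℤ ↥V n) y) hc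
    simp only [mayerVietoris.φ, biprod_snd_lift_apply] at h
    rw [← ModuleCat.comp_apply, biprod.inl_snd] at h
    simpa using h
  have hc0 : c = 0 := hmono (by rw [h2, map_zero])
  -- first component: `x = i_U c = 0`
  have h3 := congrArg (fun y => (biprod.fst : singularHomology ℤ ℤ ↥U n ⊞
    singularHomology ℤ ℤ ↥V n ⟶ singularHomology ℤ ℤ ↥U n) y) hc
  simp only [mayerVietoris.φ, biprod_fst_lift_apply] at h3
  rw [← ModuleCat.comp_apply, biprod.inl_fst, hc0, map_zero] at h3
  simpa using h3.symm

end MV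

namespace FramedSphereFamily

/-! ### The unit tube and its projection to the core -/

section Tube

variable {k l : ℕ}

/-- The open unit tube `Sᵏ × Bˡ⁺¹` as a subset of `Sᵏ × ℝˡ⁺¹`. [folklore] -/
def unitTube (k l : ℕ) : Set ((𝕊 k) × (𝔼 (l + 1))) := {q | ‖q.2‖ < 1}

/-- The punctured tube inside the unit tube. [folklore] -/
theorem puncturedUnitTube_subset_unitTube : puncturedUnitTube k l ⊆ unitTube k l :=
  fun _ hq => hq.2

/-- The inclusion of the punctured tube in the unit tube. [folklore] -/
def inclPT (k l : ℕ) : C(↥(puncturedUnitTube k l), ↥(unitTube k l)) :=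
  subsetInclusion puncturedUnitTube_subset_unitTube

/-- The projection of the unit tube onto the core direction `Sᵏ`. [folklore] -/
def fstUnitTube (k l : ℕ) : C(↥(unitTube k l), 𝕊 k) :=
  ⟨fun q => q.1.1, continuous_fst.comp continuous_subtype_val⟩

/-- `fstUnitTube ∘ inclPT = pr₁ ∘ (radial retraction)` on the punctured tube. [folklore] -/
theorem fstUnitTube_comp_inclPT :
    (fstUnitTube k l).comp (inclPT k l) =
      (ContinuousMap.fst : C((𝕊 k) × (𝕊 l), 𝕊 k)).comp (tubeRetractionFun k l) := rfl

/-- **`Hₖ(punctured tube) → Hₖ(unit tube)` is injective** (`k ≠ l`, `k, l ≥ 2`): followed by the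
projection to `Sᵏ` it is the isomorphism `isIso_map_fstTube` (the parallel survives in the full
tube `Sᵏ × Bˡ⁺¹ ≃ Sᵏ`). Kervaire–Milnor 1963, p. 516: `i(ε) = λ`. [cite: KervaireMilnorAnnals1963, Lemma 5.6, proof (p. 516)] -/
theorem mono_map_inclPT (hk : 2 ≤ k) (hl : 2 ≤ l) (hkl : k ≠ l) :
    Mono (singularHomology.map ℤ ℤ (inclPT k l) k) := by
  haveI : IsIso (singularHomology.map ℤ ℤ (inclPT k l) k ≫ singularHomology.map ℤ ℤ (fstUnitTube k l) k) := by
    rw [← singularHomology.map_comp, fstUnitTube_comp_inclPT]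
    exact isIso_map_fstTube hk hl hkl
  exact mono_of_mono (singularHomology.map ℤ ℤ (inclPT k l) k)
    (singularHomology.map ℤ ℤ (fstUnitTube k l) k)

end Tube

/-! ### The open tube `T = φ(Sᵏ × Bˡ⁺¹)` in `X` and the cover `X = (X ∖ S) ∪ T` -/

section OpenTube

variable {EX HX : Type*} [NormedAddCommGroup EX] [NormedSpace ℝ EX] [TopologicalSpace HX]
  {IX : ModelWithCorners ℝ EX HX} {X : Type} [TopologicalSpace X] [ChartedSpace HX X] [T2Space X]
  {ι : Type} [Unique ι] {k l : ℕ} (ν : FramedSphereFamily IX X ι k (l + 1))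

/-- **The open unit tube `T = φ(Sᵏ × Bˡ⁺¹)` of the (unique) framed sphere** (Kervaire–Milnor
1963, p. 515: `φ(Sᵏ × Dᵏ⁺¹)`, here open). [cite: KervaireMilnorAnnals1963, Lemma 5.6, proof (p. 515)] -/
def openTube : Set X := ν.toFun default '' unitTube k l

omit [T2Space X] in
/-- The open tube is open. [folklore] -/
theorem isOpen_openTube : IsOpen ν.openTube :=
  (ν.isOpenEmbedding_toFun default).isOpenMap _
    (isOpen_lt (continuous_norm.comp continuous_snd) continuous_const)

/-- **`(X ∖ S) ∪ T = X`**: the core `S` lies in the tube. [folklore] -/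
theorem complement_union_openTube : (ν.complement : Set X) ∪ ν.openTube = univ := by
  refine eq_univ_of_forall fun x => ?_
  by_cases hx : x ∈ (ν.complement : Set X)
  · exact Or.inl hx
  · have hx' : x ∈ ν.cores := by
      by_contra h
      exact hx h
    obtain ⟨i, v, rfl⟩ := ν.mem_cores_iff.1 hx'
    rw [Subsingleton.elim i default]
    exact Or.inr ⟨(v, 0), by simp [unitTube], rfl⟩

/-- **`(X ∖ S) ∩ T = φ(punctured tube)`**. [folklore] -/
theorem complement_inter_openTube :
    (ν.complement : Set X) ∩ ν.openTube = ν.toFun default '' puncturedUnitTube k l := by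
  ext x
  constructor
  · rintro ⟨hxA, ⟨⟨u, w⟩, hw, rfl⟩⟩
    refine ⟨(u, w), ⟨fun h0 => ?_, hw⟩, rfl⟩
    subst h0
    have : ν.toFun default (u, 0) ∈ ν.cores := by
      rw [← sphere_apply]; exact ν.sphere_mem_cores default u
    exact hxA this
  · rintro ⟨q, hq, rfl⟩
    exact ⟨ν.apply_mem_complement_of_mem default hq, ⟨q, hq.2, rfl⟩⟩

/-- The punctured tube as the intersection `(X ∖ S) ∩ T`, through `φ`. [folklore] -/
def interHomeomorph : ↥(puncturedUnitTube k l) ≃ₜ ↥((ν.complement : Set X) ∩ ν.openTube) :=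
  ((ν.isOpenEmbedding_toFun default).isEmbedding.homeomorphImage (puncturedUnitTube k l)).trans
    (Homeomorph.setCongr ν.complement_inter_openTube.symm)

/-- The unit tube as the open tube `T`, through `φ`. [folklore] -/
def openTubeHomeomorph : ↥(unitTube k l) ≃ₜ ↥ν.openTube :=
  (ν.isOpenEmbedding_toFun default).isEmbedding.homeomorphImage (unitTube k l)

/-- **`Hₖ((X ∖ S) ∩ T) → Hₖ(T)` is injective** (`k ≠ l`, `k, l ≥ 2`): transport of
`mono_map_inclPT` through `φ`. [cite: KervaireMilnorAnnals1963, Lemma 5.6, proof (p. 516)] -/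
theorem mono_map_inter_openTube (hk : 2 ≤ k) (hl : 2 ≤ l) (hkl : k ≠ l) :
    Mono (singularHomology.map ℤ ℤ (subsetInclusion
      (inter_subset_right : (ν.complement : Set X) ∩ ν.openTube ⊆ ν.openTube)) k) :=
  mono_map_of_conj ℤ ℤ (inclPT k l) _ ν.interHomeomorph ν.openTubeHomeomorph (fun _ => rfl) k
    (mono_map_inclPT hk hl hkl)

/-- **`Hₖ(X ∖ S) → Hₖ(X)` is injective** for a framed `k`-sphere with fibre `ℝˡ⁺¹`, `k ≠ l`,
`k, l ≥ 2` — Kervaire–Milnor 1963, proof of Lemma 5.6, p. 516 (the vertical sequence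
`ℤ —ε→ HₖM₀ —i→ HₖM` with `i(ε) = λ`: a class of `M₀` dying in `M` is a multiple of the parallel
`ε`, and `ε` does not die in the tube). Mayer–Vietoris for `X = (X ∖ S) ∪ T`.
[cite: KervaireMilnorAnnals1963, Lemma 5.6, proof (p. 516)] -/
theorem mono_map_complement_val (hk : 2 ≤ k) (hl : 2 ≤ l) (hkl : k ≠ l) :
    Mono (singularHomology.map ℤ ℤ (subsetIncl (ν.complement : Set X)) k) :=
  mono_map_left_of_mono_inter_right (ν.complement : Set X) ν.openTube ν.complement.isOpen
    ν.isOpen_openTube ν.complement_union_openTube k (ν.mono_map_inter_openTube hk hl hkl)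

end OpenTube

/-! ### `Hₖ(X ∖ S)` dies in `P` when the classes orthogonal to `S` are multiples of `[S]` -/

section Gluing

variable {EX HX : Type*} [NormedAddCommGroup EX] [NormedSpace ℝ EX] [TopologicalSpace HX]
  {IX : ModelWithCorners ℝ EX HX} {X : Type} [TopologicalSpace X] [ChartedSpace HX X] [T2Space X]
  {ι : Type} [Unique ι] {k l : ℕ} {ν : FramedSphereFamily IX X ι k (l + 1)}
  {P : Type} [TopologicalSpace P] {jA : ↥ν.complement → P} {jB : ↥(ballTimesSphere ι k l) → P}
  (hA : IsOpenEmbedding jA) (hB : IsOpenEmbedding jB) (hcov : range jA ∪ range jB = univ)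
  (hrel : ∀ a b, jA a = jB b ↔ sphereFamilySurgeryRel ν a b)

include hA hB hrel in
/-- **The Lagrangian condition kills `Hₖ(X ∖ S)` in `P`.** Let `k ≠ l`, `k, l ≥ 2`, and suppose
that every class `x ∈ Hₖ(X; ℤ)` with `x ↦ 0` in `Hₖ(X, X ∖ S; ℤ)` is in the image of
`Hₖ(S) = Hₖ(Sᵏ)` under the core sphere (i.e. a multiple of `[S]`). Then `(jA)_* : Hₖ(X ∖ S) →
Hₖ(P)` vanishes: a class `a` of `X ∖ S` maps into that kernel (exact sequence of the pair), so
equals, by the injectivity `Hₖ(X ∖ S) ↪ Hₖ(X)` (`mono_map_complement_val`) and `i(ε) = λ`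
(`map_parallelSphere_eq_map_sphere`), the corresponding multiple of the parallel, which bounds a
disc of the handle in `P` (`map_jA_parallelSphere_eq_zero`). Kervaire–Milnor 1963, Lemma 7.1,
proof (p. 527), case `r = 1`. [cite: KervaireMilnorAnnals1963, Lemma 7.1, proof (p. 527), with Lemma 5.6 (p. 516)] -/
theorem map_jA_eq_zero_of_lagrangian (hk : 2 ≤ k) (hl : 2 ≤ l) (hkl : k ≠ l)
    (hlag : ∀ x : singularHomology ℤ ℤ X k,
      relativeSingularHomology.ofAbsolute ℤ ℤ X (ν.complement : Set X) k x = 0 →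
        x ∈ LinearMap.range (singularHomology.map ℤ ℤ ν.sphereMap k).hom) :
    singularHomology.map ℤ ℤ (⟨jA, hA.continuous⟩ : C(↥ν.complement, P)) k = 0 := by
  -- a parallel `u ↦ φ(u, v₀)` with `0 < ‖v₀‖ < 1`
  set v₀ : 𝔼 (l + 1) := (2⁻¹ : ℝ) • EuclideanSpace.single 0 1 with hv₀def
  have hv₀ : v₀ ≠ 0 := by
    rw [hv₀def]; exact smul_ne_zero (by norm_num) (by simp)
  have hv₁ : ‖v₀‖ < 1 := by
    rw [hv₀def, norm_smul]; simp; norm_num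
  haveI := ν.mono_map_complement_val hk hl hkl
  ext a
  -- the image `x` of `a` in `H_k(X)` dies in `H_k(X, X ∖ S)`, hence is `[S]_* θ`
  have hx : relativeSingularHomology.ofAbsolute ℤ ℤ X (ν.complement : Set X) k
      (singularHomology.map ℤ ℤ (subsetIncl (ν.complement : Set X)) k a) = 0 := by
    rw [← ModuleCat.comp_apply, relativeSingularHomology.map_comp_ofAbsolute]
    rfl
  obtain ⟨θ, hθ⟩ := hlag _ hx
  -- so `a` is the parallel class `(φ(-, v₀))_* θ`
  have ha : a = singularHomology.map ℤ ℤ (ν.parallelSphere hv₀) k θ := by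
    apply (ModuleCat.mono_iff_injective _).1 ‹Mono (singularHomology.map ℤ ℤ
      (subsetIncl (ν.complement : Set X)) k)›
    rw [← ModuleCat.comp_apply, ← singularHomology.map_comp,
      map_parallelSphere_eq_map_sphere ℤ ℤ hv₀ k]
    exact hθ.symm
  rw [ha, ← ModuleCat.comp_apply, ← singularHomology.map_comp,
    map_jA_parallelSphere_eq_zero ℤ ℤ hrel hB.continuous hA.continuous hv₀ hv₁ (by omega : k ≠ 0)]
  rfl

/-- **`Hₗ₊₁(P) = 0` for a surgery in the middle dimension on a Lagrangian generator.** Let `P` be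
glued from `X ∖ S` and the handle `OD^{l+2} × Sˡ` along a framed `(l+1)`-sphere `S` with fibre
`ℝˡ⁺¹`, `l ≥ 2` (the middle dimension `k = l + 1` of the `2k`-manifold `X`). If every class of
`Hₖ(X; ℤ)` dying in `Hₖ(X, X ∖ S; ℤ)` is a multiple of `[S]` (for a Kervaire–Milnor basis
`{λ, μ}` of rank `2`: `x·λ = 0 ⟹ x ∈ ℤλ`), then `Hₖ(P; ℤ) = 0`: Mayer–Vietoris for
`P = jA(X ∖ S) ∪ jB(handle)` with `Hₖ(X ∖ S) → Hₖ(P)` zero (`map_jA_eq_zero_of_lagrangian`),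
`Hₖ(OD × Sˡ) = 0`, and `Hₗ(jA(A) ∩ jB(B)) → Hₗ(jB(B))` injective (the meridian,
`isIso_map_inter_right`). Kervaire–Milnor 1963, Lemma 7.1 (proof, p. 527) for `r = 1`: "The
group `HₖM'` … has basis `{λ'₁, …, λ'ᵣ₋₁, μ'₁, …, μ'ᵣ₋₁}`". [cite: KervaireMilnorAnnals1963, Lemma 7.1, proof (p. 527)] [cite: Kosinski1993, Ch. X §3, proof of Thm. (3.4)] -/
theorem isZero_singularHomology_succ_of_middleSurgery {ν : FramedSphereFamily IX X ι (l + 1) (l + 1)}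
    {jA : ↥ν.complement → P} {jB : ↥(ballTimesSphere ι (l + 1) l) → P}
    (hA : IsOpenEmbedding jA) (hB : IsOpenEmbedding jB) (hcov : range jA ∪ range jB = univ)
    (hrel : ∀ a b, jA a = jB b ↔ sphereFamilySurgeryRel ν a b) (hl : 2 ≤ l)
    (hlag : ∀ x : singularHomology ℤ ℤ X (l + 1),
      relativeSingularHomology.ofAbsolute ℤ ℤ X (ν.complement : Set X) (l + 1) x = 0 →
        x ∈ LinearMap.range (singularHomology.map ℤ ℤ ν.sphereMap (l + 1)).hom) :
    IsZero (singularHomology ℤ ℤ P (l + 1)) := by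
  -- the `U`-summand dies: transport `(jA)_* = 0` to `range jA`
  have hjA := map_jA_eq_zero_of_lagrangian hA hB hrel (by omega) hl (by omega) hlag
  have hjU : singularHomology.map ℤ ℤ (subsetIncl (range jA)) (l + 1) = 0 := by
    have hfac : subsetIncl (range jA) =
        (⟨jA, hA.continuous⟩ : C(↥ν.complement, P)).comp
          (hA.isEmbedding.toHomeomorph.symm : C(↥(range jA), ↥ν.complement)) := by
      ext y
      obtain ⟨a, rfl⟩ := hA.isEmbedding.toHomeomorph.surjective y
      show (hA.isEmbedding.toHomeomorph a : P) = jA (hA.isEmbedding.toHomeomorph.symm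
        (hA.isEmbedding.toHomeomorph a))
      rw [Homeomorph.symm_apply_apply]
      rfl
    rw [hfac, singularHomology.map_comp, hjA, comp_zero]
  -- the `V`-summand: `H_{l+1}(OD × Sˡ) = 0`
  have hV0 : IsZero (singularHomology ℤ ℤ ↥(range jB) (l + 1)) :=
    (isZero_singularHomology_ballTimesSphere ℤ ℤ ι (Nat.succ_ne_zero l) (by omega)).of_iso
      (singularHomology.mapIso ℤ ℤ hB.isEmbedding.toHomeomorph.symm (l + 1))
  have hjV : singularHomology.map ℤ ℤ (subsetIncl (range jB)) (l + 1) = 0 := hV0.eq_of_src _ _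
  -- `φ_l` is injective through the meridian
  haveI := isIso_map_inter_right hA hB hrel (by omega : 2 ≤ l + 1) hl (by omega)
  exact isZero_of_mayerVietoris_of_map_eq_zero (range jA) (range jB) hA.isOpen_range
    hB.isOpen_range hcov l hjU hjV
    (mono_mayerVietoris_φ_of_mono_right _ _ l inferInstance)

/-- **The homology of a surgery on a primitive Lagrangian middle-dimensional sphere**
(Kervaire–Milnor 1963, Lemma 7.1 for `r = 1`, with Lemma 5.6; Kosinski 1993, X.3, proof of
Thm. (3.4) with Prop. (1.3)). Let `X` be a Hausdorff manifold, `S ⊂ X` a framed `(l+1)`-sphere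
with fibre `ℝˡ⁺¹` (`l ≥ 2`; `dim X = 2l + 2`, `S` of the middle dimension `k = l + 1 ≥ 3`), and
`P` the result of the surgery (glued from `X ∖ S` and `OD^{l+2} × Sˡ`, `hA hB hcov hrel`).
Assume (i) `Hₗ(X; ℤ) = 0`; (ii) **primitivity**: `Hₖ(X; ℤ) → Hₖ(X, X ∖ S; ℤ)` is onto ("`μ·λ = 1`
for some `μ`"); (iii) **the Lagrangian condition**: its kernel consists of multiples of `[S]`
("`λ·λ = 0`" and `{λ, μ}` a basis). Then `Hₗ(P; ℤ) = 0` and `Hₗ₊₁(P; ℤ) = 0` — "`HₖM` can be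
killed" for a middle homology of rank `2`. The degrees below `l` and simple connectivity are
`isZero_singularHomology_of_surgery` / `simplyConnectedSpace_of_surgery` of the tree.
[cite: KervaireMilnorAnnals1963, Lemma 7.1 (pp. 526–528) with Lemma 5.6 (pp. 514–516)] [cite: Kosinski1993, Ch. X §1 Prop. (1.3) and §3 proof of Thm. (3.4)] -/
theorem isZero_singularHomology_of_middleSurgery {ν : FramedSphereFamily IX X ι (l + 1) (l + 1)}
    {jA : ↥ν.complement → P} {jB : ↥(ballTimesSphere ι (l + 1) l) → P}
    (hA : IsOpenEmbedding jA) (hB : IsOpenEmbedding jB) (hcov : range jA ∪ range jB = univ)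
    (hrel : ∀ a b, jA a = jB b ↔ sphereFamilySurgeryRel ν a b) (hl : 2 ≤ l)
    (hX : IsZero (singularHomology ℤ ℤ X l))
    (hprim : Epi (relativeSingularHomology.ofAbsolute ℤ ℤ X (ν.complement : Set X) (l + 1)))
    (hlag : ∀ x : singularHomology ℤ ℤ X (l + 1),
      relativeSingularHomology.ofAbsolute ℤ ℤ X (ν.complement : Set X) (l + 1) x = 0 →
        x ∈ LinearMap.range (singularHomology.map ℤ ℤ ν.sphereMap (l + 1)).hom) :
    IsZero (singularHomology ℤ ℤ P l) ∧ IsZero (singularHomology ℤ ℤ P (l + 1)) :=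
  ⟨isZero_singularHomology_of_middleSurgery_of_epi hA hB hcov hrel hl (Nat.lt_succ_self l) hX hprim,
    isZero_singularHomology_succ_of_middleSurgery hA hB hcov hrel hl hlag⟩

end Gluing

end FramedSphereFamily

/-! ### Surgery on a null-cobordism along one middle-dimensional sphere -/

namespace NullCobordism

variable {n l : ℕ} {M : Type} [TopologicalSpace M] [ChartedSpace (EuclideanSpace ℝ (Fin n)) M]
  [IsManifold (𝓡 n) ∞ M]

/-- **"`HₖM` can be killed" for a middle homology of rank `2`** (Kervaire–Milnor 1963, Lemma 7.1
for `r = 1`, with Thm. 6.6's `bM₁ = bM`; Kosinski 1993, X.3, proof of Thm. (3.4) for one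
surgery). Let `M = ∂W` (`c : NullCobordism n M`, `n = 2l + 1`, so `dim W = 2l + 2 = 2k` with
`k = l + 1 ≥ 3`), `W` simply connected with `Hᵢ(W; ℤ) = 0` for `0 < i ≤ l` (`(k-1)`-connected),
and `ν` ONE framed `k`-sphere `S` with fibre `ℝᵏ` in `W` such that (primitivity) `Hₖ(W) →
Hₖ(W, W ∖ S)` is onto and (Lagrangian condition) its kernel consists of multiples of `[S]`. Then
the surgered null-cobordism `χ(W, S)` of the same `M` (`c.surgery ν _`, boundary unchanged) is
simply connected with `Hᵢ(χ; ℤ) = 0` for `0 < i ≤ l + 1 = k`: degrees `< l` by Kosinski X.1.1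
(`isZero_singularHomology_surgered`), `π₁` by `simplyConnectedSpace_surgered`, and degrees
`l`, `l + 1` by `FramedSphereFamily.isZero_singularHomology_of_middleSurgery`.
[cite: KervaireMilnorAnnals1963, Lemma 7.1 (pp. 526–528), Thm. 6.6 (p. 526), p. 514 (bM₁ = bM)] [cite: Kosinski1993, Ch. X §3, proof of Thm. (3.4), with §1 Prop. (1.1), (1.3)] -/
theorem simplyConnected_and_isZero_surgery_of_middleSphere (hn : l + 1 + l = n) (hl : 2 ≤ l)
    (c : NullCobordism n M) [SimplyConnectedSpace c.W]
    (ν : FramedSphereFamily (𝓡∂ (n + 1)) c.W Unit (l + 1) (l + 1))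
    (hH : ∀ i : ℕ, 0 < i → i ≤ l → IsZero (singularHomology ℤ ℤ c.W i))
    (hprim : Epi (relativeSingularHomology.ofAbsolute ℤ ℤ c.W (ν.complement : Set c.W) (l + 1)))
    (hlag : ∀ x : singularHomology ℤ ℤ c.W (l + 1),
      relativeSingularHomology.ofAbsolute ℤ ℤ c.W (ν.complement : Set c.W) (l + 1) x = 0 →
        x ∈ LinearMap.range (singularHomology.map ℤ ℤ ν.sphereMap (l + 1)).hom) :
    SimplyConnectedSpace (c.surgery ν hn).W ∧
      ∀ i : ℕ, 0 < i → i ≤ l + 1 → IsZero (singularHomology ℤ ℤ (c.surgery ν hn).W i) := by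
  obtain ⟨hA, hB, hcov, hrel⟩ := ν.surgered_gluing hn
  refine ⟨ν.simplyConnectedSpace_surgered hn (by omega) hl, fun i hi hil => ?_⟩
  show IsZero (singularHomology ℤ ℤ (ν.Surgered hn) i)
  rcases lt_trichotomy i l with hlt | rfl | hgt
  · -- below: Kosinski X.1.1
    obtain ⟨m, rfl⟩ : ∃ m, i = m + 1 := ⟨i - 1, by omega⟩
    exact ν.isZero_singularHomology_surgered hn ℤ ℤ (m := m) (by omega) (by omega)
      (hH (m + 1) hi (by omega))
  · -- degree `l`: the meridian
    exact FramedSphereFamily.isZero_singularHomology_of_middleSurgery_of_epi hA hB hcov hrel hl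
      (Nat.lt_succ_self i) (hH i hi le_rfl) hprim
  · -- degree `l + 1 = k`: the parallel
    obtain rfl : i = l + 1 := by omega
    exact FramedSphereFamily.isZero_singularHomology_succ_of_middleSurgery hA hB hcov hrel hl hlag

end NullCobordism

end Literature.Topology.FourManifolds

end
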